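import Literature.AlgebraicGeometry.Modules.SerreTwistHyperplaneClass
import Literature.AlgebraicGeometry.Motives.SegreEmbedding
import Literature.AlgebraicGeometry.Motives.ProjectiveLineInvolution
import Literature.AlgebraicGeometry.Motives.ProjBaseChangeAny
import Literature.AlgebraicGeometry.Modules.SerreTwistModProjMap
import Literature.AlgebraicGeometry.RelativeSpec.SymmetricPower
import HarnessLib

/-!
# The class of the Serre twist along a Segre product of two maps to projective space:
# `[𝒪_X(-m)]_{σ} = [𝒪_X(-m)]_{φ} · [𝒪_X(-m)]_{ψ}` in `Ȟ¹(X, 𝒪_X^×)`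

Topic `AlgebraicGeometry/Modules`, namespace `Literature.AlgebraicGeometry.Modules.SerreTwist`.  THEOREMS ONLY (no definition,
no instance, no notation, no `sorry`).  Cell `hodgecm-mathlib` (D-0151): F-13 «Plücker class of the linearly rigidified covariant»,
piece P1 of the census `B-provers/B-p10/g13/CENSUS-F13-PluckerPL.B-p10g13.md` (director s281: HOME-only seed; generic `Modules/`
brick).  HC_CM is proved only modulo the 7 printed citations until rung 0 closes; nothing here is about HC.

## The source, as printed

[Hartshorne1977] II Ex. 5.11 (p. 125): the Segre embedding `ψ : 𝐏ʳ ×_A 𝐏ˢ → 𝐏ᴺ`, `N = rs + r + s`, given on homogeneous coordinates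
by `z_{ij} = x_i y_j`, with `ψ^* 𝒪(1) ≅ p₁^* 𝒪(1) ⊗ p₂^* 𝒪(1)` (II Ex. 5.12 (b): for closed immersions the twisting sheaves multiply).
Read through a scheme `X` with two morphisms `φ : X → 𝐏ᵃ_k`, `ψ : X → 𝐏ᵇ_k` over `Spec k` and `σ := (φ, ψ) ≫ Segre : X → 𝐏ᶜ_k`
(`c + 1 = (a+1)(b+1)` through any bijection `e : Fin (a+1) × Fin (b+1) ≃ Fin (c+1)`): **`σ^*𝒪(-m) ≅ φ^*𝒪(-m) ⊗ ψ^*𝒪(-m)`**, here on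
determinant classes in the tree's Čech Picard group `CechPic X` (★ `Modules/UnitCocycle`):

  `detClass (serreTwist σ m) = detClass (serreTwist φ m) * detClass (serreTwist ψ m)`.

## Proof (chartwise; no integrality, no Cartier divisors)

The chart `X_{z_{ij}} = σ⁻¹ D₊(z_{ij})` is `φ⁻¹D₊(x_i) ∩ ψ⁻¹D₊(y_j)` (★ `Segre.segre_preimage_basicOpen`), and on it the chart function
`z_{i'j'}/z_{ij}` of `σ` is the product `(x_{i'}/x_i) · (y_{j'}/y_j)` of the chart functions of `φ` and `ψ` (§1: the universal identity
on `𝐏ᵃ ×_k 𝐏ᵇ`, checked after restriction to the affine chart `D₊(x_i) ×_k D₊(y_j)` where the Segre map is `Spec` of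
`z_t/z_{ij} ↦ (x/x_i)(y/y_j)` — ★ `Segre.segreRingHom_frac`, ★ `Segre.prodCover_f_segre`; the restriction is injective because the chart
is an open immersion onto `X_{z_{ij}}`).  The chart frame systems of the three Serre twists (★ `SerreTwist.transitionDet_chartFrame`:
transition functions `(x_i/x_{i'})^m`) therefore have, on the common refinement `φ⁻¹D₊(x_{i(x)}) ∩ ψ⁻¹D₊(y_{j(x)})`, cocycles with
`g^σ = g^φ · g^ψ`, which is the product in `CechPic` (★ `CechPic.mk_mul`, ★ `detClass_eq_mk`) — §2 (stated for any
`L : X → 𝐏ᵃ ×_A 𝐏ᵇ`); §3 is the consumer form for a pair `(φ, ψ)` over `Spec A` (Mathlib `pullback.lift`), with the structure-map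
compatibility and «immersion as soon as `φ` is» (★ `Segre.isClosedImmersion_segre`, Mathlib `IsImmersion.of_comp`); §0 collects three
restriction lemmas (sections of `𝒪(D₊(f))` pulled back through the chart `Spec (k[x]_{(f)})₀`, ★ `ProjLine.res_awayι_awayToSection`);
§4 is the companion «change of the coefficient ring»: along `π : 𝐏ʳ_L → 𝐏ʳ_k` (Mathlib `Proj.map` of ★ `ProjBaseChangeRing.mapGraded`)
the charts and chart functions of `ι ≫ π` are those of `ι` (★ `Modules/SerreTwistModProjMap`: `Zop_comp_projMap`, `map_chartFun_comp_projMap`),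
so `[𝒪_Z(-m)]_{ι ≫ π} = [𝒪_Z(-m)]_ι` ([Hartshorne1977] II Prop. 5.12 (c)) —
the form in which a map to `𝐏ʳ_ℤ` paired with a structure map to `Spec ℚ` becomes a map to `𝐏ʳ_ℚ` with the same twist classes;
§5 iterates §2 along the tree's fibre powers (★ `RelativeSpec.powOver` / `powSuccIso`): the `n+1`-fold fibre power of `𝐏ᵐ_A` over
`Spec A` is CLOSED-immersed in one `𝐏ᴿ_A` over `Spec A` with twist classes the product of the factors' (`exists_segre_powOver`).

## References
* [Hartshorne1977] R. Hartshorne, *Algebraic Geometry*, GTM 52 (1977): II Ex. 5.11 (p. 125), II Ex. 5.12 (b), II Prop. 5.12 (b) (p. 117),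
  II Ex. 5.16 (d), II Thm. 7.1 (a) (p. 150).
* [GortzWedhorn2020] U. Görtz, T. Wedhorn, *Algebraic Geometry I*, 2nd ed. (2020): (4.14) the Segre embedding (pp. 114–115); (13.8).
-/

noncomputable section

universe u

open CategoryTheory CategoryTheory.Limits AlgebraicGeometry TopologicalSpace Opposite HomogeneousLocalization
open Literature.Algebra.Homology Literature.Algebra.Homology.LaurentCech
open Literature.AlgebraicGeometry.Morphisms Literature.AlgebraicGeometry.Morphisms.ProjCech
open Literature.AlgebraicGeometry.Motives Literature.AlgebraicGeometry.Motives.Segre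
open Literature.AlgebraicGeometry.Motives.GeneratingSections (homRatio preU homRatio_eq_appLE homRatio_comp_eq_appLE)

-- (U153: no local instance attribute; the `PP`∕`Segre.grading` gradings are found through ★ `ProjCech.grading`∕`Segre.grading`)

namespace Literature.AlgebraicGeometry.Modules

namespace SerreTwist

/-! ## §0 Three restriction lemmas: sections of `𝒪(D₊(f))` pulled back along maps through the chart `Spec (A_{(f)})₀` -/

section Res

variable {k : Type u} [CommRing k]

/-- Pulling the canonical section of `b ∈ (k[x]_{(f)})₀` over `D₊(f)` back along `γ ≫ (Spec (k[x]_{(f)})₀ ↪ Proj)` gives `γ^* b`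
(★ `ProjLine.res_awayι_awayToSection`). [cite: Hartshorne1977, II Prop. 2.5 (b)] -/
theorem res_comp_awayι_awayToSection {ι : Type} {T : Scheme.{u}} :
    letI := MvPolynomial.gradedAlgebra (σ := ι) (R := k)
    ∀ (f : MvPolynomial ι k) {d : ℕ} (hf : f ∈ Segre.grading ι k d)
    (hd : 0 < d) (γ : T ⟶ Spec (.of (Away (Segre.grading ι k) f)))
    (h : ⊤ ≤ (γ ≫ Proj.awayι (Segre.grading ι k) f hf hd) ⁻¹ᵁ Proj.basicOpen (Segre.grading ι k) f)
    (b : Away (Segre.grading ι k) f),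
    GeneratingSections.res (γ ≫ Proj.awayι (Segre.grading ι k) f hf hd) (Proj.basicOpen (Segre.grading ι k) f) h
      (Proj.awayToSection (Segre.grading ι k) f b) = pull γ b := by
  letI := MvPolynomial.gradedAlgebra (σ := ι) (R := k)
  intro f d hf hd γ h b
  have h' : ⊤ ≤ Proj.awayι (Segre.grading ι k) f hf hd ⁻¹ᵁ Proj.basicOpen (Segre.grading ι k) f :=
    (Scheme.Hom.preimage_opensRange (Proj.awayι (Segre.grading ι k) f hf hd)).symm.trans_le
      (Scheme.Hom.preimage_mono _ (Proj.opensRange_awayι (Segre.grading ι k) f hf hd).le)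
  rw [GeneratingSections.res_comp (Proj.awayι (Segre.grading ι k) f hf hd) _ h' γ h, RingHom.comp_apply,
    ProjLine.res_awayι_awayToSection, pull_apply]

/-- `pull` along `T ⟶ Spec Γ(T, 𝒪_T) ⟶ Spec R` for a ring map `F : R → Γ(T, 𝒪_T)` is `F`. [folklore] -/
private theorem pull_toSpecΓ_SpecMap {T : Scheme.{u}} {R : CommRingCat.{u}} (F : R ⟶ Γ(T, ⊤)) (r : R) :
    pull (T.toSpecΓ ≫ Spec.map F) r = F r := by
  rw [pull_SpecMap, pull_apply, Scheme.toSpecΓ_appTop]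
  exact CategoryTheory.Iso.inv_hom_id_apply _ _

variable {ι κ τ : Type} (e : ι × κ ≃ τ) {T : Scheme.{u}} (i : ι) (j : κ)

/-- **The chart-level Segre map pulls the canonical sections of `𝒪(D₊(z_{ij}))` back by `segreRingHom`**: for
`s ∈ (k[z]_{(z_{ij})})₀`, `segreMap^*(s) = segreRingHom s` (★ `Segre.segreMap` is `T → Spec Γ(T) → Spec (k[z]_{(z_{ij})})₀ ↪ Proj`).
[cite: Hartshorne1977, II Ex. 5.11 (p. 125)] -/
theorem res_segreMap_awayToSection :
    letI := MvPolynomial.gradedAlgebra (σ := ι) (R := k)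
    letI := MvPolynomial.gradedAlgebra (σ := κ) (R := k)
    letI := MvPolynomial.gradedAlgebra (σ := τ) (R := k)
    ∀ (α : T ⟶ Spec (.of (Away (Segre.grading ι k) (MvPolynomial.X i))))
    (β : T ⟶ Spec (.of (Away (Segre.grading κ k) (MvPolynomial.X j))))
    (h : ⊤ ≤ segreMap e i j α β ⁻¹ᵁ Proj.basicOpen (Segre.grading τ k) (MvPolynomial.X (e (i, j))))
    (s : Away (Segre.grading τ k) (MvPolynomial.X (e (i, j)))),
    GeneratingSections.res (segreMap e i j α β) (Proj.basicOpen (Segre.grading τ k) (MvPolynomial.X (e (i, j)))) h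
      (Proj.awayToSection (Segre.grading τ k) (MvPolynomial.X (e (i, j))) s) = segreRingHom e i j α β s := by
  letI := MvPolynomial.gradedAlgebra (σ := ι) (R := k)
  letI := MvPolynomial.gradedAlgebra (σ := κ) (R := k)
  letI := MvPolynomial.gradedAlgebra (σ := τ) (R := k)
  intro α β h s
  have h' : ⊤ ≤ ((T.toSpecΓ ≫ Spec.map (CommRingCat.ofHom (segreRingHom e i j α β))) ≫ chartι k (e (i, j))) ⁻¹ᵁ
      Proj.basicOpen (Segre.grading τ k) (MvPolynomial.X (e (i, j))) := by
    simpa only [segreMap, Category.assoc] using h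
  have : GeneratingSections.res (segreMap e i j α β) (Proj.basicOpen (Segre.grading τ k) (MvPolynomial.X (e (i, j)))) h =
      GeneratingSections.res ((T.toSpecΓ ≫ Spec.map (CommRingCat.ofHom (segreRingHom e i j α β))) ≫ chartι k (e (i, j)))
        (Proj.basicOpen (Segre.grading τ k) (MvPolynomial.X (e (i, j)))) h' := by
    simp only [segreMap, Category.assoc]
  rw [this, res_comp_awayι_awayToSection, pull_toSpecΓ_SpecMap]
  rfl

end Res

/-! ## §1 The universal identity on `𝐏(ι) ×_k 𝐏(κ)`: `z_{i'j'}/z_{ij} = (x_{i'}/x_i) · (y_{j'}/y_j)` on `p₁⁻¹D₊(x_i) ∩ p₂⁻¹D₊(y_j)` -/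

section Universal

variable (k : Type u) [CommRing k] {ι κ τ : Type} (e : ι × κ ≃ τ)

/-- Restriction along a morphism is functorial in the morphism, with the dependent proof transported. [folklore] -/
private theorem res_congr {T Y : Scheme.{u}} {f g : T ⟶ Y} (efg : f = g) (V : Y.Opens) (h : ⊤ ≤ f ⁻¹ᵁ V) :
    GeneratingSections.res f V h = GeneratingSections.res g V (efg ▸ h) := by
  subst efg
  rfl

/-- Restricting `g^*` of a section along `f` is restricting the section along `f ≫ g` (Mathlib `appLE_comp_appLE`). [folklore] -/
private theorem res_appLE {T Y Z : Scheme.{u}} (f : T ⟶ Y) (g : Y ⟶ Z) (U : Z.Opens) (V : Y.Opens) (e₁ : V ≤ g ⁻¹ᵁ U)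
    (h : ⊤ ≤ f ⁻¹ᵁ V) (s : Γ(Z, U)) :
    GeneratingSections.res f V h (g.appLE U V e₁ s) = GeneratingSections.res (f ≫ g) U (h.trans (f.preimage_mono e₁)) s := by
  change (g.appLE U V e₁ ≫ f.appLE V ⊤ h) s = _
  rw [Scheme.Hom.appLE_comp_appLE]
  rfl

/-- Restriction of sections to the image of an open immersion is injective (it is Mathlib's `Scheme.Hom.appIso`). [folklore] -/
private theorem res_injective_of_range_eq {T Y : Scheme.{u}} (f : T ⟶ Y) [IsOpenImmersion f] {W : Y.Opens}
    (hW : Set.range f = (W : Set Y)) (h : ⊤ ≤ f ⁻¹ᵁ W) : Function.Injective (GeneratingSections.res f W h) := by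
  have hW' : f ''ᵁ ⊤ = W := by
    rw [Scheme.Hom.image_top_eq_opensRange]
    exact Opens.ext (by rw [Scheme.Hom.coe_opensRange, hW])
  subst hW'
  have : GeneratingSections.res f (f ''ᵁ ⊤) h = (f.appIso ⊤).hom.hom := by
    rw [Scheme.Hom.appIso_hom']
    rfl
  rw [this]
  exact (f.appIso ⊤).commRingCatIsoToRingEquiv.injective

/-- **The Segre chart `σ⁻¹D₊(z_{ij})` is `p₁⁻¹D₊(x_i) ∩ p₂⁻¹D₊(y_j)`** (★ `Segre.segre_preimage_basicOpen`, in the `preU` spelling of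
★ `GeneratingSections.ofHom`). [cite: Hartshorne1977, II Ex. 5.11 (p. 125)] -/
theorem preU_segre (i : ι) (j : κ) :
    preU (segre k e) (e (i, j)) =
      preU (pullback.fst (Segre.toSpec ι k) (Segre.toSpec κ k)) i ⊓ preU (pullback.snd (Segre.toSpec ι k) (Segre.toSpec κ k)) j :=
  segre_preimage_basicOpen k e i j

/-- The product chart `D₊(x_i) ×_k D₊(y_j) ↪ 𝐏(ι) ×_k 𝐏(κ)` lands in the Segre chart `σ⁻¹D₊(z_{ij})`. [folklore] -/
private theorem top_le_prodCover_f_preimage_preU_segre (i : ι) (j : κ) :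
    ⊤ ≤ (prodCover ι κ k).f (i, j) ⁻¹ᵁ preU (segre k e) (e (i, j)) := by
  rintro x -
  change ((prodCover ι κ k).f (i, j)) x ∈ (preU (segre k e) (e (i, j)) : Set _)
  rw [preU_segre, ← range_prodCover_f]
  exact ⟨x, rfl⟩

/-- **THE SEGRE CHART IDENTITY**: on `σ⁻¹D₊(z_{ij}) = p₁⁻¹D₊(x_i) ∩ p₂⁻¹D₊(y_j)` the ratio `σ^*(z_{i'j'}/z_{ij})` of the Segre map is the
product `p₁^*(x_{i'}/x_i) · p₂^*(y_{j'}/y_j)` ([Hartshorne1977] II Ex. 5.11: «`z_{ij} = x_i y_j`»).  Both sides are determined by their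
restriction to the affine chart `D₊(x_i) ×_k D₊(y_j)` (an open immersion onto the Segre chart), where the Segre map is `Spec` of
`z_t/z_{ij} ↦ (x_{t₁}/x_i)(y_{t₂}/y_j)` (★ `Segre.segreRingHom_frac`, ★ `Segre.prodCover_f_segre`, §0).
[cite: Hartshorne1977, II Ex. 5.11 (p. 125)] -/
theorem homRatio_segre (i i' : ι) (j j' : κ) :
    homRatio (segre k e) (e (i, j)) (e (i', j')) =
      (pullback (Segre.toSpec ι k) (Segre.toSpec κ k)).presheaf.map
          (homOfLE ((preU_segre k e i j).le.trans inf_le_left)).op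
          (homRatio (pullback.fst (Segre.toSpec ι k) (Segre.toSpec κ k)) i i') *
        (pullback (Segre.toSpec ι k) (Segre.toSpec κ k)).presheaf.map
          (homOfLE ((preU_segre k e i j).le.trans inf_le_right)).op
          (homRatio (pullback.snd (Segre.toSpec ι k) (Segre.toSpec κ k)) j j') := by
  letI := MvPolynomial.gradedAlgebra (σ := ι) (R := k)
  letI := MvPolynomial.gradedAlgebra (σ := κ) (R := k)
  letI := MvPolynomial.gradedAlgebra (σ := τ) (R := k)
  haveI : IsOpenImmersion ((prodCover ι κ k).f (i, j)) := (prodCover ι κ k).map_prop (i, j)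
  have h := top_le_prodCover_f_preimage_preU_segre k e i j
  have hrange : Set.range ((prodCover ι κ k).f (i, j)) = (preU (segre k e) (e (i, j)) : Set _) := by
    rw [range_prodCover_f, preU_segre]
  apply res_injective_of_range_eq ((prodCover ι κ k).f (i, j)) hrange h
  have h₁ : ⊤ ≤ (prodCover ι κ k).f (i, j) ⁻¹ᵁ preU (pullback.fst (Segre.toSpec ι k) (Segre.toSpec κ k)) i :=
    h.trans (Scheme.Hom.preimage_mono _ ((preU_segre k e i j).le.trans inf_le_left))
  have h₂ : ⊤ ≤ (prodCover ι κ k).f (i, j) ⁻¹ᵁ preU (pullback.snd (Segre.toSpec ι k) (Segre.toSpec κ k)) j :=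
    h.trans (Scheme.Hom.preimage_mono _ ((preU_segre k e i j).le.trans inf_le_right))
  -- the Segre ratio restricts to `segreRingHom (z_{i'j'}/z_{ij}) = (x_{i'}/x_i) ⊗ (y_{j'}/y_j)` on the chart
  have hA : GeneratingSections.res ((prodCover ι κ k).f (i, j)) _ h (homRatio (segre k e) (e (i, j)) (e (i', j'))) =
      pull (chartFst k (i, j)) (frac k i i') * pull (chartSnd k (i, j)) (frac k j j') := by
    rw [homRatio_eq_appLE, res_appLE, res_congr (prodCover_f_segre k e (i, j)),
      res_congr (show segreChart k e (i, j) = segreMap e i j (chartFst k (i, j)) (chartSnd k (i, j)) from rfl),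
      res_segreMap_awayToSection e i j (chartFst k (i, j)) (chartSnd k (i, j)), segreRingHom_frac]
    exact segreFun_X_apply e i j (chartFst k (i, j)) (chartSnd k (i, j)) i' j'
  -- the two factor ratios restrict to `x_{i'}/x_i ⊗ 1` and `1 ⊗ y_{j'}/y_j`
  have hB : GeneratingSections.res ((prodCover ι κ k).f (i, j)) _ h
      ((pullback (Segre.toSpec ι k) (Segre.toSpec κ k)).presheaf.map (homOfLE ((preU_segre k e i j).le.trans inf_le_left)).op
        (homRatio (pullback.fst (Segre.toSpec ι k) (Segre.toSpec κ k)) i i')) = pull (chartFst k (i, j)) (frac k i i') := by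
    rw [GeneratingSections.res_map _ _ h₁, homRatio_eq_appLE, res_appLE, res_congr (prodCover_f_fst k (i, j))]
    exact res_comp_awayι_awayToSection (MvPolynomial.X i) (X_mem k i) zero_lt_one (chartFst k (i, j)) _ _
  have hC : GeneratingSections.res ((prodCover ι κ k).f (i, j)) _ h
      ((pullback (Segre.toSpec ι k) (Segre.toSpec κ k)).presheaf.map (homOfLE ((preU_segre k e i j).le.trans inf_le_right)).op
        (homRatio (pullback.snd (Segre.toSpec ι k) (Segre.toSpec κ k)) j j')) = pull (chartSnd k (i, j)) (frac k j j') := by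
    rw [GeneratingSections.res_map _ _ h₂, homRatio_eq_appLE, res_appLE, res_congr (prodCover_f_snd k (i, j))]
    exact res_comp_awayι_awayToSection (MvPolynomial.X j) (X_mem k j) zero_lt_one (chartSnd k (i, j)) _ _
  rw [map_mul, hA, hB, hC]

end Universal

/-! ## §2 The Serre twists along `σ = (φ, ψ) ≫ Segre`: charts, chart functions, classes -/

section Classes

variable {A : Type u} [CommRing A] {a b c : ℕ} (e : Fin (a + 1) × Fin (b + 1) ≃ Fin (c + 1)) {X : Scheme.{u}}
  (L : X ⟶ pullback (Segre.toSpec (Fin (a + 1)) A) (Segre.toSpec (Fin (b + 1)) A))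

/-- Restricting `f^*` of a restricted section: `(f^*(s|_U))|_{V'} = f^*s` on `V'`. [folklore] -/
private theorem map_appLE_map {Y : Scheme.{u}} (f : X ⟶ Y) {U U' : Y.Opens} {V V' : X.Opens} (h : V ≤ f ⁻¹ᵁ U) (hU : U ≤ U')
    (hV : V' ≤ V) (s : Γ(Y, U')) :
    X.presheaf.map (homOfLE hV).op (f.appLE U V h (Y.presheaf.map (homOfLE hU).op s)) =
      f.appLE U' V' (hV.trans (h.trans (f.preimage_mono hU))) s := by
  rw [← CommRingCat.comp_apply, Scheme.Hom.appLE_map, ← CommRingCat.comp_apply, Scheme.Hom.map_appLE]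

/-- Restricting `f^*s`: `(f^*s)|_{V'} = f^*s` on `V'`. [folklore] -/
private theorem map_appLE {Y : Scheme.{u}} (f : X ⟶ Y) {U : Y.Opens} {V V' : X.Opens} (h : V ≤ f ⁻¹ᵁ U) (hV : V' ≤ V)
    (s : Γ(Y, U)) :
    X.presheaf.map (homOfLE hV).op (f.appLE U V h s) = f.appLE U V' (hV.trans h) s := by
  rw [← CommRingCat.comp_apply, Scheme.Hom.appLE_map]

/-- **The Segre chart of `X`**: `X_{z_{ij}} = σ⁻¹D₊(z_{ij}) = φ⁻¹D₊(x_i) ∩ ψ⁻¹D₊(y_j)` for `σ = L ≫ Segre`, `φ = L ≫ p₁`, `ψ = L ≫ p₂`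
(§1 pulled back along `L`). [cite: Hartshorne1977, II Ex. 5.11 (p. 125)] -/
theorem Zop_segre (i : Fin (a + 1)) (j : Fin (b + 1)) :
    Zop (L ≫ segre A e : X ⟶ PP A c) {e (i, j)} =
      Zop (L ≫ pullback.fst (Segre.toSpec (Fin (a + 1)) A) (Segre.toSpec (Fin (b + 1)) A) : X ⟶ PP A a) {i} ⊓
        Zop (L ≫ pullback.snd (Segre.toSpec (Fin (a + 1)) A) (Segre.toSpec (Fin (b + 1)) A) : X ⟶ PP A b) {j} := by
  rw [Zop_singleton_eq_preU, Zop_singleton_eq_preU, Zop_singleton_eq_preU]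
  change L ⁻¹ᵁ preU (segre A e) (e (i, j)) = L ⁻¹ᵁ preU (pullback.fst _ _) i ⊓ L ⁻¹ᵁ preU (pullback.snd _ _) j
  rw [preU_segre, Scheme.Hom.preimage_inf]

/-- **The chart functions of `σ` are the products of those of `φ` and `ψ`**: `σ^*(z_{i'j'}/z_{ij}) = φ^*(x_{i'}/x_i) · ψ^*(y_{j'}/y_j)`
on any open below the three charts (§1 ★ `homRatio_segre` along `L`, in the `chartFun` dialect of ★ `Modules/SerreTwist` via
★ `map_homRatio_eq_map_chartFun`). [cite: Hartshorne1977, II Ex. 5.11 (p. 125)] -/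
theorem map_chartFun_segre (i i' : Fin (a + 1)) (j j' : Fin (b + 1)) {V : X.Opens}
    (hφ : V ≤ Zop (L ≫ pullback.fst (Segre.toSpec (Fin (a + 1)) A) (Segre.toSpec (Fin (b + 1)) A) : X ⟶ PP A a) {i})
    (hψ : V ≤ Zop (L ≫ pullback.snd (Segre.toSpec (Fin (a + 1)) A) (Segre.toSpec (Fin (b + 1)) A) : X ⟶ PP A b) {j})
    (hσ : V ≤ Zop (L ≫ segre A e : X ⟶ PP A c) {e (i, j)}) :
    X.presheaf.map (homOfLE hσ).op (chartFun (L ≫ segre A e : X ⟶ PP A c) (e (i', j')) (e (i, j))) =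
      X.presheaf.map (homOfLE hφ).op
          (chartFun (L ≫ pullback.fst (Segre.toSpec (Fin (a + 1)) A) (Segre.toSpec (Fin (b + 1)) A) : X ⟶ PP A a) i' i) *
        X.presheaf.map (homOfLE hψ).op
          (chartFun (L ≫ pullback.snd (Segre.toSpec (Fin (a + 1)) A) (Segre.toSpec (Fin (b + 1)) A) : X ⟶ PP A b) j' j) := by
  rw [← map_homRatio_eq_map_chartFun _ _ _ (hσ.trans (Zop_singleton_eq_preU _ _).le),
    ← map_homRatio_eq_map_chartFun _ _ _ (hφ.trans (Zop_singleton_eq_preU _ _).le),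
    ← map_homRatio_eq_map_chartFun _ _ _ (hψ.trans (Zop_singleton_eq_preU _ _).le),
    homRatio_comp_eq_appLE, homRatio_comp_eq_appLE, homRatio_comp_eq_appLE, homRatio_segre, map_mul, map_mul,
    map_appLE_map, map_appLE_map, map_appLE, map_appLE]

/-- **THE SEGRE PRODUCT FORMULA FOR SERRE TWISTS** ([Hartshorne1977] II Ex. 5.11 / Ex. 5.12 (b): `σ^*𝒪(1) ≅ p₁^*𝒪(1) ⊗ p₂^*𝒪(1)`):
for `L : X → 𝐏ᵃ ×_A 𝐏ᵇ` with components `φ = L ≫ p₁`, `ψ = L ≫ p₂` and Segre composite `σ = L ≫ Segre : X → 𝐏ᶜ` (`c+1 = (a+1)(b+1)`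
through `e`), the determinant classes of the Serre twists in `Ȟ¹(X, 𝒪_X^×)` multiply: **`[σ^*𝒪(-m)] = [φ^*𝒪(-m)] · [ψ^*𝒪(-m)]`**.
The chart frame systems (★ `transitionDet_chartFrame`) on the refinement `φ⁻¹D₊(x_{i(x)}) ∩ ψ⁻¹D₊(y_{j(x)}) = σ⁻¹D₊(z_{i(x)j(x)})`
have cocycles `g^σ = g^φ g^ψ` (★ `map_chartFun_segre`), and `CechPic.mk` is multiplicative (★ `CechPic.mk_mul`).
[cite: Hartshorne1977, II Ex. 5.11 (p. 125)] [cite: Hartshorne1977, II Prop. 5.12 (b)] -/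
theorem detClass_serreTwist_segre (m : ℕ) :
    detClass (isFiniteLocallyFree_serreTwist (L ≫ segre A e : X ⟶ PP A c) m) =
      detClass (isFiniteLocallyFree_serreTwist
          (L ≫ pullback.fst (Segre.toSpec (Fin (a + 1)) A) (Segre.toSpec (Fin (b + 1)) A) : X ⟶ PP A a) m) *
        detClass (isFiniteLocallyFree_serreTwist
          (L ≫ pullback.snd (Segre.toSpec (Fin (a + 1)) A) (Segre.toSpec (Fin (b + 1)) A) : X ⟶ PP A b) m) := by
  classical
  -- notation for the three maps
  set φ : X ⟶ PP A a := L ≫ pullback.fst (Segre.toSpec (Fin (a + 1)) A) (Segre.toSpec (Fin (b + 1)) A) with hφ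
  set ψ : X ⟶ PP A b := L ≫ pullback.snd (Segre.toSpec (Fin (a + 1)) A) (Segre.toSpec (Fin (b + 1)) A) with hψ
  set σ : X ⟶ PP A c := L ≫ segre A e with hσ
  -- chart choices for `φ` and `ψ`; the Segre chart at `x` is `z_{i(x) j(x)}`
  choose ia hia using exists_mem_Zop_singleton φ
  choose jb hjb using exists_mem_Zop_singleton ψ
  have hZ : ∀ z, Zop σ {e (ia z, jb z)} = Zop φ {ia z} ⊓ Zop ψ {jb z} := fun z => Zop_segre e L (ia z) (jb z)
  have hmem : ∀ z, z ∈ Zop σ {e (ia z, jb z)} := fun z => by rw [hZ]; exact ⟨hia z, hjb z⟩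
  -- the three chart frame systems
  let Gφ : FrameSystem (serreTwist φ m) :=
    { U := fun z => Zop φ {ia z}
      mem := hia
      I := fun _ => PUnit.{u + 1}
      rank := fun _ => 1
      enum := fun _ => _root_.Equiv.ofUnique PUnit (Fin 1)
      frame := fun z => freePUnitIso (Zop φ {ia z}) ≪≫ (overIsoUnit φ m (ia z)).symm }
  let Gψ : FrameSystem (serreTwist ψ m) :=
    { U := fun z => Zop ψ {jb z}
      mem := hjb
      I := fun _ => PUnit.{u + 1}
      rank := fun _ => 1
      enum := fun _ => _root_.Equiv.ofUnique PUnit (Fin 1)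
      frame := fun z => freePUnitIso (Zop ψ {jb z}) ≪≫ (overIsoUnit ψ m (jb z)).symm }
  let Gσ : FrameSystem (serreTwist σ m) :=
    { U := fun z => Zop σ {e (ia z, jb z)}
      mem := hmem
      I := fun _ => PUnit.{u + 1}
      rank := fun _ => 1
      enum := fun _ => _root_.Equiv.ofUnique PUnit (Fin 1)
      frame := fun z => freePUnitIso (Zop σ {e (ia z, jb z)}) ≪≫ (overIsoUnit σ m (e (ia z, jb z))).symm }
  have hGφ : ∀ (x y : X) (V : X.Opens) (hx : V ≤ Zop φ {ia x}) (hy : V ≤ Zop φ {ia y}),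
      Gφ.cocycle.g x y V hx hy = X.presheaf.map (homOfLE hy).op (chartFun φ (ia x) (ia y)) ^ m :=
    fun x y V hx hy => transitionDet_chartFrame φ m (ia x) (ia y) hx hy
  have hGψ : ∀ (x y : X) (V : X.Opens) (hx : V ≤ Zop ψ {jb x}) (hy : V ≤ Zop ψ {jb y}),
      Gψ.cocycle.g x y V hx hy = X.presheaf.map (homOfLE hy).op (chartFun ψ (jb x) (jb y)) ^ m :=
    fun x y V hx hy => transitionDet_chartFrame ψ m (jb x) (jb y) hx hy
  have hGσ : ∀ (x y : X) (V : X.Opens) (hx : V ≤ Zop σ {e (ia x, jb x)}) (hy : V ≤ Zop σ {e (ia y, jb y)}),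
      Gσ.cocycle.g x y V hx hy = X.presheaf.map (homOfLE hy).op (chartFun σ (e (ia x, jb x)) (e (ia y, jb y))) ^ m :=
    fun x y V hx hy => transitionDet_chartFrame σ m (e (ia x, jb x)) (e (ia y, jb y)) hx hy
  rw [detClass_eq_mk _ Gσ, detClass_eq_mk _ Gφ, detClass_eq_mk _ Gψ, ← CechPic.mk_mul]
  refine CechPic.sound (UnitCocycle.equiv_of_eq _ _ (fun z => Zop φ {ia z} ⊓ Zop ψ {jb z}) (fun z => ⟨hia z, hjb z⟩)
    (fun z => (hZ z).ge) (fun _ => le_rfl) fun x y V hx hy => ?_)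
  change Gφ.cocycle.g x y V _ _ * Gψ.cocycle.g x y V _ _ = Gσ.cocycle.g x y V _ _
  rw [hGφ, hGψ, hGσ, ← mul_pow, map_chartFun_segre e L (ia y) (ia x) (jb y) (jb x) (hy.trans inf_le_left)
    (hy.trans inf_le_right) (hy.trans (hZ y).ge)]

end Classes

/-! ## §3 Consumer forms: two maps `φ, ψ` over `Spec A` and their Segre product `(φ, ψ) ≫ Segre` -/

section Pair

variable {A : Type u} [CommRing A] {a b c : ℕ} (e : Fin (a + 1) × Fin (b + 1) ≃ Fin (c + 1)) {X : Scheme.{u}}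
  (φ : X ⟶ PP A a) (ψ : X ⟶ PP A b) (w : φ ≫ Segre.toSpec (Fin (a + 1)) A = ψ ≫ Segre.toSpec (Fin (b + 1)) A)

/-- The two spellings of the structure morphism `𝐏ʳ_A → Spec A` in the tree agree: ★ `ProjCech.toSpec A r` (= ★
`ProjBaseChangeRing.projToSpec`) is ★ `Segre.toSpec (Fin (r+1)) A`, definitionally (the structure morphism `𝐏ʳ_A → Spec A` of
[Hartshorne1977] II Ex. 5.11). [cite: Hartshorne1977, II Ex. 5.11 (p. 125)] -/
theorem toSpec_eq_segreToSpec (r : ℕ) : ProjCech.toSpec A r = Segre.toSpec (Fin (r + 1)) A := rfl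

/-- **`[((φ, ψ) ≫ Segre)^*𝒪(-m)] = [φ^*𝒪(-m)] · [ψ^*𝒪(-m)]`** for two morphisms `φ : X → 𝐏ᵃ_A`, `ψ : X → 𝐏ᵇ_A` over `Spec A`
(★ `detClass_serreTwist_segre` at `L := (φ, ψ)`, Mathlib `pullback.lift_fst/_snd`). [cite: Hartshorne1977, II Ex. 5.11 (p. 125)]
[cite: Hartshorne1977, II Prop. 5.12 (b)] -/
theorem detClass_serreTwist_segre_lift (m : ℕ) :
    detClass (isFiniteLocallyFree_serreTwist (pullback.lift φ ψ w ≫ segre A e : X ⟶ PP A c) m) =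
      detClass (isFiniteLocallyFree_serreTwist φ m) * detClass (isFiniteLocallyFree_serreTwist ψ m) := by
  have h := detClass_serreTwist_segre e (pullback.lift φ ψ w) m
  simp only [pullback.lift_fst, pullback.lift_snd] at h
  exact h

/-- The Segre product of two maps over `Spec A` is a map over `Spec A` (★ `Segre.segre_toSpec`; the Segre embedding is an
`A`-morphism, [Hartshorne1977] II Ex. 5.11). [cite: Hartshorne1977, II Ex. 5.11 (p. 125)] -/
theorem segre_lift_toSpec : (pullback.lift φ ψ w ≫ segre A e) ≫ Segre.toSpec (Fin (c + 1)) A = φ ≫ Segre.toSpec (Fin (a + 1)) A := by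
  rw [Category.assoc, segre_toSpec, pullback.lift_fst_assoc]

/-- **The Segre product of two maps is an immersion as soon as the pair `(φ, ψ)` is** — in particular when `φ` (or `ψ`) is an
immersion (the pair followed by a projection is `φ`; Mathlib `IsImmersion.of_comp`) — since the Segre map is a closed immersion
(★ `Segre.isClosedImmersion_segre`). [cite: Hartshorne1977, II Ex. 5.11 (p. 125)] [cite: GortzWedhorn2020, (4.14) (pp. 114–115)] -/
theorem isImmersion_lift_segre [IsImmersion φ] : IsImmersion (pullback.lift φ ψ w ≫ segre A e) := by
  haveI : IsImmersion (pullback.lift φ ψ w ≫ pullback.fst (Segre.toSpec (Fin (a + 1)) A) (Segre.toSpec (Fin (b + 1)) A)) := by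
    rw [pullback.lift_fst]; infer_instance
  haveI : IsImmersion (pullback.lift φ ψ w) :=
    IsImmersion.of_comp _ (pullback.fst (Segre.toSpec (Fin (a + 1)) A) (Segre.toSpec (Fin (b + 1)) A))
  haveI := isClosedImmersion_segre A e
  infer_instance

end Pair




/-! ## §4 Change of the coefficient ring: `[𝒪_Z(-m)]_{ι ≫ (𝐏ʳ_L → 𝐏ʳ_k)} = [𝒪_Z(-m)]_ι` -/

section BaseRing

variable (k L : Type u) [CommRing k] [CommRing L] [Algebra k L] {r : ℕ}

/-- **Change of coefficient ring does not change the class of the Serre twist**: for `ι : Z → 𝐏ʳ_L` and the base-change map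
`π : 𝐏ʳ_L → 𝐏ʳ_k` of a ring map `k → L` (Mathlib `Proj.map` of ★ `ProjBaseChangeRing.mapGraded`), `[𝒪_Z(-m)]_{ι ≫ π} = [𝒪_Z(-m)]_ι`
in `Ȟ¹(Z, 𝒪_Z^×)` (`π^*𝒪_{𝐏ʳ_k}(1) = 𝒪_{𝐏ʳ_L}(1)`): same charts (★ `Zop_comp_projMap`) and same transition functions
`(x_j/x_{j'})^m` (★ `map_chartFun_comp_projMap`, ★ `transitionDet_chartFrame`).  [cite: Hartshorne1977, II Prop. 5.12 (c)] -/
theorem detClass_serreTwist_comp_projMap {Z : Scheme.{u}} (ι : Z ⟶ PP L r) (m : ℕ) :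
    letI := MvPolynomial.gradedAlgebra (σ := Fin (r + 1)) (R := k)
    letI := MvPolynomial.gradedAlgebra (σ := Fin (r + 1)) (R := L)
    detClass (isFiniteLocallyFree_serreTwist (ι ≫ Proj.map (ProjBaseChangeRing.mapGraded k L (Fin (r + 1)))
      (ProjBaseChangeRing.irrelevant_le_map k L (Fin (r + 1))) : Z ⟶ PP k r) m) =
      detClass (isFiniteLocallyFree_serreTwist ι m) := by
  classical
  letI := MvPolynomial.gradedAlgebra (σ := Fin (r + 1)) (R := k)
  letI := MvPolynomial.gradedAlgebra (σ := Fin (r + 1)) (R := L)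
  set ι' : Z ⟶ PP k r := ι ≫ Proj.map (ProjBaseChangeRing.mapGraded k L (Fin (r + 1)))
    (ProjBaseChangeRing.irrelevant_le_map k L (Fin (r + 1))) with hι'
  choose a ha using exists_mem_Zop_singleton ι
  have hZ : ∀ s, Zop ι' s = Zop ι s := fun s => Zop_comp_projMap k L ι s
  let G : FrameSystem (serreTwist ι m) :=
    { U := fun z => Zop ι {a z}
      mem := ha
      I := fun _ => PUnit.{u + 1}
      rank := fun _ => 1
      enum := fun _ => _root_.Equiv.ofUnique PUnit (Fin 1)
      frame := fun z => freePUnitIso (Zop ι {a z}) ≪≫ (overIsoUnit ι m (a z)).symm }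
  let G' : FrameSystem (serreTwist ι' m) :=
    { U := fun z => Zop ι' {a z}
      mem := fun z => by rw [hZ]; exact ha z
      I := fun _ => PUnit.{u + 1}
      rank := fun _ => 1
      enum := fun _ => _root_.Equiv.ofUnique PUnit (Fin 1)
      frame := fun z => freePUnitIso (Zop ι' {a z}) ≪≫ (overIsoUnit ι' m (a z)).symm }
  have hG : ∀ (x y : Z) (V : Z.Opens) (hx : V ≤ Zop ι {a x}) (hy : V ≤ Zop ι {a y}),
      G.cocycle.g x y V hx hy = Z.presheaf.map (homOfLE hy).op (chartFun ι (a x) (a y)) ^ m :=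
    fun x y V hx hy => transitionDet_chartFrame ι m (a x) (a y) hx hy
  have hG' : ∀ (x y : Z) (V : Z.Opens) (hx : V ≤ Zop ι' {a x}) (hy : V ≤ Zop ι' {a y}),
      G'.cocycle.g x y V hx hy = Z.presheaf.map (homOfLE hy).op (chartFun ι' (a x) (a y)) ^ m :=
    fun x y V hx hy => transitionDet_chartFrame ι' m (a x) (a y) hx hy
  rw [detClass_eq_mk _ G', detClass_eq_mk _ G]
  refine CechPic.sound (UnitCocycle.equiv_of_eq _ _ (fun z => Zop ι {a z}) ha (fun z => (hZ _).ge) (fun _ => le_rfl)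
    fun x y V hx hy => ?_)
  rw [hG, hG', ← map_chartFun_comp_projMap k L ι (a x) (a y), ← CommRingCat.comp_apply, ← Functor.map_comp]
  rfl

end BaseRing

/-! ## §5 Segre powers: the `n+1`-fold fibre power of `𝐏ᵐ_A` over `Spec A` is closed-immersed in one `𝐏ᴿ_A`, with twist
classes the product of the factors' -/

section Powers

variable (A : Type u) [CommRing A] (m : ℕ)

/-- **Iterated Segre embedding of a fibre power of `𝐏ᵐ_A`** ([Hartshorne1977] II Ex. 5.11 iterated; the tree's fibre power
★ `RelativeSpec.powOver (𝐏ᵐ_A → Spec A) (n+1)` = Mathlib `widePullback`): there are `R` and a CLOSED IMMERSION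
`s : (𝐏ᵐ_A)^{n+1}_{Spec A} ↪ 𝐏ᴿ_A` over `Spec A` such that for every `L : X → (𝐏ᵐ_A)^{n+1}` the class of the Serre twist along
`L ≫ s` is the product of the classes along the `n+1` components `L ≫ prⱼ` (induction on `n` along ★ `RelativeSpec.powSuccIso`
with §2 `detClass_serreTwist_segre`; the step's pairing map is Mathlib `pullback.map` of two closed immersions).
[cite: Hartshorne1977, II Ex. 5.11 (p. 125)] [cite: Hartshorne1977, II Prop. 5.12 (b)] -/
theorem exists_segre_powOver : ∀ n : ℕ,
    ∃ (R : ℕ) (s : RelativeSpec.powOver (ProjCech.toSpec A m) (n + 1) ⟶ PP A R), IsClosedImmersion s ∧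
      s ≫ ProjCech.toSpec A R = RelativeSpec.powOver.base (ProjCech.toSpec A m) (n + 1) ∧
      ∀ (X : Scheme.{u}) (L : X ⟶ RelativeSpec.powOver (ProjCech.toSpec A m) (n + 1)) (t : ℕ),
        detClass (isFiniteLocallyFree_serreTwist (L ≫ s) t) =
          ∏ i, detClass (isFiniteLocallyFree_serreTwist (L ≫ RelativeSpec.powOver.proj (ProjCech.toSpec A m) (n + 1) i) t)
  | 0 => by
    have h0 : RelativeSpec.powOver.proj (ProjCech.toSpec A m) 1 0 =
        (RelativeSpec.powSuccIso (ProjCech.toSpec A m) 0).hom ≫ pullback.snd _ _ :=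
      (RelativeSpec.powSuccToPullback_snd (ProjCech.toSpec A m) 0).symm
    refine ⟨m, RelativeSpec.powOver.proj (ProjCech.toSpec A m) 1 0, ?_, WidePullback.π_arrow _ _, fun X L t => ?_⟩
    · rw [h0]; infer_instance
    · rw [Fin.prod_univ_one]
  | n + 1 => by
    obtain ⟨R, s, hs, hsb, hcl⟩ := exists_segre_powOver n
    have hR : (R + 1) * (m + 1) = R * m + R + m + 1 := by ring
    let e : Fin (R + 1) × Fin (m + 1) ≃ Fin (R * m + R + m + 1) := finProdFinEquiv.trans (finCongr hR)
    have w : (pullback.fst (RelativeSpec.powOver.base (ProjCech.toSpec A m) (n + 1)) (ProjCech.toSpec A m) ≫ s) ≫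
        Segre.toSpec (Fin (R + 1)) A =
        pullback.snd (RelativeSpec.powOver.base (ProjCech.toSpec A m) (n + 1)) (ProjCech.toSpec A m) ≫
          Segre.toSpec (Fin (m + 1)) A := by
      rw [Category.assoc, ← toSpec_eq_segreToSpec, hsb, pullback.condition]; rfl
    refine ⟨R * m + R + m, (RelativeSpec.powSuccIso (ProjCech.toSpec A m) (n + 1)).hom ≫ pullback.lift _ _ w ≫ segre A e,
      ?_, ?_, fun X L t => ?_⟩
    · -- closed immersion: the pairing map is `pullback.map` of the closed immersions `s` and `𝟙`
      have hl : pullback.lift _ _ w = pullback.map (RelativeSpec.powOver.base (ProjCech.toSpec A m) (n + 1)) (ProjCech.toSpec A m)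
          (Segre.toSpec (Fin (R + 1)) A) (Segre.toSpec (Fin (m + 1)) A) s (𝟙 _) (𝟙 _)
          ((Category.comp_id _).trans hsb.symm) ((Category.comp_id _).trans (Category.id_comp _).symm) := by
        apply pullback.hom_ext
        · rw [pullback.lift_fst, pullback.lift_fst]
        · rw [pullback.lift_snd, pullback.lift_snd, Category.comp_id]
      haveI : IsClosedImmersion (pullback.lift _ _ w) := by
        rw [hl]
        exact MorphismProperty.pullbackMap (P := @IsClosedImmersion) hs (inferInstance : IsClosedImmersion (𝟙 _)) hsb.symm
          (Category.id_comp _).symm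
      haveI := isClosedImmersion_segre A e
      infer_instance
    · -- over `Spec A`
      change ((RelativeSpec.powSuccIso (ProjCech.toSpec A m) (n + 1)).hom ≫ pullback.lift _ _ w ≫ segre A e) ≫
        Segre.toSpec (Fin (R * m + R + m + 1)) A = _
      rw [Category.assoc, segre_lift_toSpec]
      change (RelativeSpec.powSuccIso (ProjCech.toSpec A m) (n + 1)).hom ≫
        (pullback.fst _ _ ≫ s) ≫ ProjCech.toSpec A R = _
      rw [Category.assoc, hsb, RelativeSpec.powSuccIso_hom_fst_base]
    · -- classes
      have e1 : ((L ≫ (RelativeSpec.powSuccIso (ProjCech.toSpec A m) (n + 1)).hom) ≫ pullback.lift _ _ w) ≫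
          pullback.fst (Segre.toSpec (Fin (R + 1)) A) (Segre.toSpec (Fin (m + 1)) A) =
          (L ≫ (RelativeSpec.powSuccIso (ProjCech.toSpec A m) (n + 1)).hom ≫
            pullback.fst (RelativeSpec.powOver.base (ProjCech.toSpec A m) (n + 1)) (ProjCech.toSpec A m)) ≫ s := by
        simp only [Category.assoc, pullback.lift_fst]
      have e2 : ((L ≫ (RelativeSpec.powSuccIso (ProjCech.toSpec A m) (n + 1)).hom) ≫ pullback.lift _ _ w) ≫
          pullback.snd (Segre.toSpec (Fin (R + 1)) A) (Segre.toSpec (Fin (m + 1)) A) =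
          L ≫ RelativeSpec.powOver.proj (ProjCech.toSpec A m) (n + 1 + 1) (Fin.last (n + 1)) := by
        rw [Category.assoc, pullback.lift_snd, Category.assoc]
        exact congrArg (L ≫ ·) (RelativeSpec.powSuccToPullback_snd (ProjCech.toSpec A m) (n + 1))
      have e3 : ((L ≫ (RelativeSpec.powSuccIso (ProjCech.toSpec A m) (n + 1)).hom) ≫ pullback.lift _ _ w) ≫ segre A e =
          L ≫ (RelativeSpec.powSuccIso (ProjCech.toSpec A m) (n + 1)).hom ≫ pullback.lift _ _ w ≫ segre A e := by
        simp only [Category.assoc]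
      have e4 : ∀ i : Fin (n + 1), (L ≫ (RelativeSpec.powSuccIso (ProjCech.toSpec A m) (n + 1)).hom ≫
          pullback.fst (RelativeSpec.powOver.base (ProjCech.toSpec A m) (n + 1)) (ProjCech.toSpec A m)) ≫
            RelativeSpec.powOver.proj (ProjCech.toSpec A m) (n + 1) i =
          L ≫ RelativeSpec.powOver.proj (ProjCech.toSpec A m) (n + 1 + 1) (Fin.castSucc i) := fun i => by
        rw [Category.assoc, Category.assoc]
        exact congrArg (L ≫ ·) (RelativeSpec.powSuccToPullback_fst_proj (ProjCech.toSpec A m) (n + 1) i)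
      have h := detClass_serreTwist_segre e ((L ≫ (RelativeSpec.powSuccIso (ProjCech.toSpec A m) (n + 1)).hom) ≫
        pullback.lift _ _ w) t
      rw [e1, e2, e3, hcl] at h
      rw [Fin.prod_univ_castSucc, h]
      congr 1
      exact Finset.prod_congr rfl fun i _ => by rw [e4 i]

end Powers

end SerreTwist

end Literature.AlgebraicGeometry.Modules

end
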